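import Mathlib
import Literature.Computability.AlgebraicComplexity.GroupTheoreticMatMul
import Literature.Barriers.MatrixMultiplication.TricoloredSumFreeBarrier
import Summits.MatrixMultiplication.MatrixMultiplication.Theorems.GroupTheoreticSTPPCThesisPackingSumset
import Summits.MatrixMultiplication.MatrixMultiplication.Theorems.AbelianSTPPCensusCrossPacking

/-!
# Sub-family packing: the joint footprint of a sub-family packs against the other members (cell mm-stpp, eng-2 g6)

For a census-STPP family `(A_i, B_i, C_i)_{i<N}` (`IsSTPP`, CKSU 2005 Def. 5.1, additive form) in a finite abelian group `H` write
`D_t = A_t − B_t` (pairwise disjoint, `|D_t| = |A_t||B_t|`) and, for an index pair `(j, k)`, the **cross set**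
`X_{jk} = (A_k − B_j) + (C_j − C_k)` (`= −((B_j − C_j) + (C_k − A_k))`; for `j = k = l` this is the U14⁺ room set
`(A_l − B_l) + (C_l − C_l)` of member `l`).  The tree's `STPPCrossPacking.disjoint_sub_cross` says `D_t ∩ X_{jk} = ∅` for every
NON-constant pattern `(t, j, k)`.  Hence for ANY index set `S`, every `D_t` with `t ∉ S` avoids the whole **footprint**
`FP(S) = ⋃_{(j,k) ∈ S × S} X_{jk}` of the sub-family `S` (a pattern `(t, j, k)` with `t ∉ S ∋ j, k` is never constant), and

* `sum_card_mul_add_card_footprint_le` — `Σ_{t ∉ S} |A_t||B_t| + |⋃_{(j,k) ∈ S×S} ((A_k − B_j) + (C_j − C_k))| ≤ |H|`,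

with the two cyclic rotations (`_BC`, `_CA`).  The case `S = {l}` is U14⁺ (`STPPPackingSumset.sum_card_mul_add_card_sumset_le`); a single
cross term of the union with ALL `D_t` is cross packing (`STPPCrossPacking.sum_card_mul_add_card_cross_le`); the UNION over `S × S` — all
`|S|²` rooms and cross sets of the sub-family at once — is the new content: it is the cardinality statement that reads `≥ 2` members JOINTLY
(cell KILL-MEMO §9 R-5 (Q-ii); SUCCESSOR-BRIEF RIDERS 10 (D‴) / 11 (D⁗)).  Pair form (`pair_footprint_le`): for `j ≠ k`,
`Σ_{t ≠ j,k} |A_t||B_t| + |X_{jj} ∪ X_{jk} ∪ X_{kj} ∪ X_{kk}| ≤ |H|`; e.g. every PAIR inside a hypothetical `(7,7,7)⁵` family at order `648`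
has all three rotated pair footprints `≤ 648 − 3·49 = 501` (`pair_footprint_le_uniform`), every triple `≤ 550`, while the full family's
footprint bound is vacuous.  At the level of SHAPES the lemma needs a lower bound for `min |FP(S)|` over STPP sub-families of given shapes in
a given group — a finite invariant this file does not compute (cell eng-2 g6 «PAIR648» measures it by search at order 648).

WHAT THIS IS NOT: no `ω` statement, no census row, no existence claim; a packing inequality about STPP families (any finite abelian group,
any shapes, any sub-family).
-/

-- single-conjunct summit: the mandated namespace repeats `MatrixMultiplication`.
set_option linter.dupNamespace false
set_option autoImplicit false

namespace Summit.MatrixMultiplication.MatrixMultiplication.Theorems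

namespace STPPSubfamilyPacking

open Finset Literature.Computability.AlgebraicComplexity
open scoped Pointwise

variable {H : Type*} [AddCommGroup H] [DecidableEq H] {N : ℕ}

/-- The **cross set** of the index pair `(j, k)`: `X_{jk} = (A_k − B_j) + (C_j − C_k)`.  For `j = k = l` it is the U14⁺ room set
`(A_l − B_l) + (C_l − C_l)` of member `l`. [original] -/
def crossSet (A B C : Fin N → Finset H) (j k : Fin N) : Finset H := (A k - B j) + (C j - C k)

/-- The **footprint** of an index set `S`: the union of all cross sets `X_{jk}`, `(j, k) ∈ S × S` — all rooms and all cross sets of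
the sub-family `S`. [original] -/
def footprint (A B C : Fin N → Finset H) (S : Finset (Fin N)) : Finset H := (S ×ˢ S).biUnion fun p => crossSet A B C p.1 p.2

variable {A B C : Fin N → Finset H}

/-- Unfolding `crossSet`. [bookkeeping] -/
theorem crossSet_eq (j k : Fin N) : crossSet A B C j k = (A k - B j) + (C j - C k) := rfl

/-- Membership in a footprint. [bookkeeping] -/
theorem mem_footprint {S : Finset (Fin N)} {x : H} :
    x ∈ footprint A B C S ↔ ∃ j ∈ S, ∃ k ∈ S, x ∈ crossSet A B C j k := by
  constructor
  · intro hx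
    rw [footprint, mem_biUnion] at hx
    obtain ⟨p, hp, hxp⟩ := hx
    rw [mem_product] at hp
    exact ⟨p.1, hp.1, p.2, hp.2, hxp⟩
  · rintro ⟨j, hj, k, hk, hx⟩
    rw [footprint, mem_biUnion]
    exact ⟨(j, k), mem_product.2 ⟨hj, hk⟩, hx⟩

/-- Each cross set of the sub-family lies in its footprint. [bookkeeping] -/
theorem crossSet_subset_footprint {S : Finset (Fin N)} {j k : Fin N} (hj : j ∈ S) (hk : k ∈ S) :
    crossSet A B C j k ⊆ footprint A B C S :=
  fun _ hx => mem_footprint.2 ⟨j, hj, k, hk, hx⟩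

/-- Footprints are monotone in the index set. [bookkeeping] -/
theorem footprint_mono {S S' : Finset (Fin N)} (hSS' : S ⊆ S') : footprint A B C S ⊆ footprint A B C S' := by
  intro x hx
  obtain ⟨j, hj, k, hk, hx⟩ := mem_footprint.1 hx
  exact mem_footprint.2 ⟨j, hSS' hj, k, hSS' hk, hx⟩

/-- The footprint of a single index is its U14⁺ room set `(A_l − B_l) + (C_l − C_l)`. [bookkeeping] -/
theorem footprint_singleton (l : Fin N) : footprint A B C {l} = (A l - B l) + (C l - C l) := by
  ext x
  rw [mem_footprint]
  constructor
  · rintro ⟨j, hj, k, hk, hx⟩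
    rw [mem_singleton] at hj hk
    subst hj; subst hk
    exact hx
  · intro hx
    exact ⟨l, mem_singleton_self l, l, mem_singleton_self l, hx⟩

/-- The footprint of a pair `{j, k}` is `X_{jj} ∪ X_{jk} ∪ X_{kj} ∪ X_{kk}`. [bookkeeping] -/
theorem footprint_pair (j k : Fin N) :
    footprint A B C {j, k} = crossSet A B C j j ∪ crossSet A B C j k ∪ crossSet A B C k j ∪ crossSet A B C k k := by
  ext x
  rw [mem_footprint]
  simp only [mem_insert, mem_singleton, mem_union]
  constructor
  · rintro ⟨j', hj', k', hk', hx⟩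
    rcases hj' with rfl | rfl <;> rcases hk' with rfl | rfl
    · exact Or.inl (Or.inl (Or.inl hx))
    · exact Or.inl (Or.inl (Or.inr hx))
    · exact Or.inl (Or.inr hx)
    · exact Or.inr hx
  · rintro (((hx | hx) | hx) | hx)
    · exact ⟨j, Or.inl rfl, j, Or.inl rfl, hx⟩
    · exact ⟨j, Or.inl rfl, k, Or.inr rfl, hx⟩
    · exact ⟨k, Or.inr rfl, j, Or.inl rfl, hx⟩
    · exact ⟨k, Or.inr rfl, k, Or.inr rfl, hx⟩

/-- A member's own difference set lies in its room set, hence in the footprint of any index set containing it (needs `C_j ≠ ∅`).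
[bookkeeping] -/
theorem sub_subset_footprint {S : Finset (Fin N)} {j : Fin N} (hj : j ∈ S) (hC : (C j).Nonempty) :
    A j - B j ⊆ footprint A B C S := by
  intro x hx
  refine crossSet_subset_footprint hj hj ?_
  rw [crossSet_eq]
  obtain ⟨c, hc⟩ := hC
  have h0 : (0 : H) ∈ C j - C j := by
    rw [mem_sub]; exact ⟨c, hc, c, hc, sub_self c⟩
  simpa using add_mem_add hx h0

/-- **Footprint disjointness.** For an `IsSTPP` family, an index set `S` and a member `t ∉ S`: the difference set `A_t − B_t` avoids the
whole footprint of `S` (every pattern `(t, j, k)` with `j, k ∈ S` is non-constant; `STPPCrossPacking.disjoint_sub_cross`).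
[cite: CohnKleinbergSzegedyUmans2005, Def. 5.1] -/
theorem disjoint_sub_footprint (h : IsSTPP A B C) {S : Finset (Fin N)} {t : Fin N} (ht : t ∉ S) :
    Disjoint (A t - B t) (footprint A B C S) := by
  rw [footprint, disjoint_biUnion_right]
  intro p hp
  rw [mem_product] at hp
  exact STPPCrossPacking.disjoint_sub_cross h fun htjk => ht (htjk.1 ▸ hp.1)

variable [Fintype H]

/-- **Sub-family packing.** For an `IsSTPP` family with all `C_t` non-empty in a finite abelian group `H` and ANY index set `S`:
`Σ_{t ∉ S} |A_t||B_t| + |⋃_{(j,k) ∈ S × S} ((A_k − B_j) + (C_j − C_k))| ≤ |H|` — the difference sets of the members outside `S`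
(pairwise disjoint, of sizes `|A_t||B_t|`) and the footprint of `S` are pairwise disjoint.  `S = {l}`: U14⁺; `S = ∅`: the packing bound.
[original] -/
theorem sum_card_mul_add_card_footprint_le (h : IsSTPP A B C) (hC : ∀ t, (C t).Nonempty) (S : Finset (Fin N)) :
    (∑ t ∈ univ \ S, (A t).card * (B t).card) + (footprint A B C S).card ≤ Fintype.card H := by
  classical
  set U : Finset H := (univ \ S).biUnion fun t => A t - B t with hU
  have hUcard : U.card = ∑ t ∈ univ \ S, (A t).card * (B t).card := by
    rw [hU, card_biUnion]
    · exact sum_congr rfl fun t _ => STPPPackingSumset.card_sub_eq h t (hC t)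
    · intro t _ t' _ htt'
      exact STPPPackingSumset.disjoint_sub_sub h htt' (hC t')
  have hdisj : Disjoint U (footprint A B C S) := by
    rw [hU, disjoint_biUnion_left]
    intro t ht
    exact disjoint_sub_footprint h (mem_sdiff.1 ht).2
  calc (∑ t ∈ univ \ S, (A t).card * (B t).card) + (footprint A B C S).card
      = (U ∪ footprint A B C S).card := by rw [card_union_of_disjoint hdisj, hUcard]
    _ ≤ Fintype.card H := card_le_univ _

/-- **Sub-family packing, `E`-form** (cyclic rotation `(A,B,C) ↦ (B,C,A)`, via `IsSTPP.rotate`): with all `A_t` non-empty,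
`Σ_{t ∉ S} |B_t||C_t| + |⋃_{(j,k) ∈ S×S} ((B_k − C_j) + (A_j − A_k))| ≤ |H|`. [original] -/
theorem sum_card_mul_add_card_footprint_le_BC (h : IsSTPP A B C) (hA : ∀ t, (A t).Nonempty) (S : Finset (Fin N)) :
    (∑ t ∈ univ \ S, (B t).card * (C t).card) + (footprint B C A S).card ≤ Fintype.card H :=
  sum_card_mul_add_card_footprint_le h.rotate hA S

/-- **Sub-family packing, `F`-form** (rotation `(A,B,C) ↦ (C,A,B)`): with all `B_t` non-empty,
`Σ_{t ∉ S} |C_t||A_t| + |⋃_{(j,k) ∈ S×S} ((C_k − A_j) + (B_j − B_k))| ≤ |H|`. [original] -/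
theorem sum_card_mul_add_card_footprint_le_CA (h : IsSTPP A B C) (hB : ∀ t, (B t).Nonempty) (S : Finset (Fin N)) :
    (∑ t ∈ univ \ S, (C t).card * (A t).card) + (footprint C A B S).card ≤ Fintype.card H :=
  sum_card_mul_add_card_footprint_le h.rotate.rotate hB S

/-- **Pair footprint packing.** For an `IsSTPP` family with all `C_t` non-empty and two indices `j, k`:
`Σ_{t ≠ j, k} |A_t||B_t| + |X_{jj} ∪ X_{jk} ∪ X_{kj} ∪ X_{kk}| ≤ |H|`, `X_{jk} = (A_k − B_j) + (C_j − C_k)` — the two rooms AND the two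
cross sets of the pair pack jointly against every other member's difference set (for `j = k` this is U14⁺ again). [original] -/
theorem pair_footprint_le (h : IsSTPP A B C) (hC : ∀ t, (C t).Nonempty) (j k : Fin N) :
    (∑ t ∈ (univ.erase j).erase k, (A t).card * (B t).card) +
        (crossSet A B C j j ∪ crossSet A B C j k ∪ crossSet A B C k j ∪ crossSet A B C k k).card ≤ Fintype.card H := by
  have hset : (univ.erase j).erase k = univ \ ({j, k} : Finset (Fin N)) := by
    ext t
    simp only [mem_erase, mem_univ, and_true, mem_sdiff, mem_insert, mem_singleton, true_and, not_or]
    tauto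
  rw [hset, ← footprint_pair]
  exact sum_card_mul_add_card_footprint_le h hC {j, k}

/-- **Pair footprints in a uniform family.**  If every member has `|A_t||B_t| = p` and all `C_t` are non-empty, then for `j ≠ k` the pair
footprint satisfies `|FP({j,k})| + (N − 2)·p ≤ |H|`; e.g. each pair inside a hypothetical `(7,7,7)⁵` family at order `648` has
`|FP| ≤ 648 − 3·49 = 501` (and the same for the two rotated footprints by `_BC` / `_CA`). [original] -/
theorem pair_footprint_le_uniform (h : IsSTPP A B C) (hC : ∀ t, (C t).Nonempty) {p : ℕ}
    (hp : ∀ t, (A t).card * (B t).card = p) {j k : Fin N} (hjk : j ≠ k) :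
    (footprint A B C {j, k}).card + (N - 2) * p ≤ Fintype.card H := by
  classical
  have hmain := sum_card_mul_add_card_footprint_le h hC {j, k}
  have hsum : ∑ t ∈ univ \ ({j, k} : Finset (Fin N)), (A t).card * (B t).card = (N - 2) * p := by
    rw [sum_congr rfl fun t _ => hp t, sum_const, smul_eq_mul]
    congr 1
    rw [card_sdiff_of_subset (subset_univ _), card_univ, Fintype.card_fin, card_pair hjk]
  rw [hsum] at hmain
  omega

/-- **Third-member exclusion by a pair** (set level).  If the pair `{j, k}` of an `IsSTPP` family (all `C_t` non-empty) has footprint of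
size `> |H| − q`, then no other member `t` has `|A_t||B_t| ≥ q`.  (E.g. the sub-punctured CKSU axes pair of `(7,7,7)`'s in
`ℤ/8 × ℤ/9 × ℤ/9` has footprint `≥ 611 > 648 − 49`, so it extends to no `(7,7,7)³` family — cell eng-2 g6, computed, not formalised here.)
[original] -/
theorem no_third_of_large_pair_footprint (h : IsSTPP A B C) (hC : ∀ t, (C t).Nonempty) {j k t : Fin N} (htj : t ≠ j) (htk : t ≠ k)
    {q : ℕ} (hq : Fintype.card H < (footprint A B C {j, k}).card + q) : (A t).card * (B t).card < q := by
  classical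
  have hmain := sum_card_mul_add_card_footprint_le h hC {j, k}
  have ht : t ∈ univ \ ({j, k} : Finset (Fin N)) := by
    simp only [mem_sdiff, mem_univ, mem_insert, mem_singleton, true_and, not_or]
    exact ⟨htj, htk⟩
  have hle : (A t).card * (B t).card ≤ ∑ u ∈ univ \ ({j, k} : Finset (Fin N)), (A u).card * (B u).card :=
    single_le_sum (f := fun u => (A u).card * (B u).card) (fun u _ => Nat.zero_le _) ht
  omega

end STPPSubfamilyPacking

end Summit.MatrixMultiplication.MatrixMultiplication.Theorems
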